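import Literature.AlgebraicGeometry.Resolution.WeightedResolutionDatum
import Literature.AlgebraicGeometry.Resolution.SmoothOfRegularPerfectField
import Mathlib.AlgebraicGeometry.Morphisms.Smooth
import Mathlib.AlgebraicGeometry.Morphisms.Separated
import Mathlib.AlgebraicGeometry.Morphisms.QuasiCompact
import Mathlib.AlgebraicGeometry.Morphisms.Affine
import Mathlib.AlgebraicGeometry.Morphisms.FiniteType
import Mathlib.AlgebraicGeometry.Noetherian
import HarnessLib

/-!
# `B₊(U) → Spec k` is smooth, separated and quasi-compact

Topic: `Summits/ResolutionOfSingularities/ResolutionOfSingularities/Theorems`. Stub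
`stub_cobordantPlus_smooth` of the line `support-first-weights-second` of the crux
`Theses.WeightedInvariant.WeightedConstruction` (statement `stmt-ResolutionOfSingularities-0571`)
of the summit `Summit.ResolutionOfSingularities.ResolutionOfSingularities`.

Granted the regularity of the full cobordant blow-up `B(U) = Spec Γ(U)[t⁻¹, Rₙ(U) tⁿ]` of an affine
chart `U` of a smooth separated quasi-compact `Y` over a field along a regular weighted centre `R`,
and that `B(U) → U` is locally of finite type (the statement of the neighbouring stub, taken as the
hypothesis `H`), the structure morphism `B₊(U) → Y → Spec k` of Włodarczyk's cobordant blow-up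
`B₊(U) = B(U) ∖ Vert` is, for `k` perfect:

* smooth — `B₊(U)` is an open subscheme of the regular `B(U)`, hence regular, and locally of finite
  type over the perfect field `k`, hence smooth (`smooth_of_isRegular_of_perfectField`);
* separated — the composite of an open immersion, the affine morphism `B(U) → U ≅ Spec Γ(Y, U)`, the
  open immersion `Spec Γ(Y, U) → Y` and the separated `f`;
* quasi-compact — `Y` and `B(U)` are locally Noetherian (locally of finite type over a field, resp.
  over the Noetherian `Γ(Y, U)`), so the two open immersions are quasi-compact, the affine morphism
  is, and `f` is by hypothesis.
-/

noncomputable section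

open CategoryTheory CategoryTheory.Limits AlgebraicGeometry TopologicalSpace
open Literature.AlgebraicGeometry.Resolution
open scoped LaurentPolynomial

-- the summit namespace repeats `ResolutionOfSingularities` by design
set_option linter.dupNamespace false

namespace Summit.ResolutionOfSingularities.ResolutionOfSingularities.Theorems

universe u

/-- An open subscheme of a regular scheme is regular: open immersions induce isomorphisms on
local rings (Stacks, Tag 02IS with 01HZ). [folklore] -/
private theorem isRegular_of_isOpenImmersion {V X : Scheme.{u}} (j : V ⟶ X) [IsOpenImmersion j]
    (h : Scheme.IsRegular X) : Scheme.IsRegular V := by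
  intro x
  haveI := h (j x)
  exact IsRegularLocalRing.of_ringEquiv (asIso (j.stalkMap x)).commRingCatIsoToRingEquiv

/-- **`B₊(U) → Spec k` is smooth, separated and quasi-compact** (stub `stub_cobordantPlus_smooth`
of line `support-first-weights-second`): granted that for every regular weighted centre `R` on a
smooth separated quasi-compact scheme `Y` over a field and every affine open `U ⊆ Y` the full
cobordant blow-up `B(U)` is regular and locally of finite type over `U`, the cobordant blow-up
`B₊(U) = B(U) ∖ Vert` of a regular weighted centre over a PERFECT field is smooth (regular and
locally of finite type over a perfect field), separated and quasi-compact over the field.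
[cite: Wlodarczyk2022, Def. 2.3.5 and Lemma 2.3.9] -/
theorem stub_cobordantPlus_smooth :
    (∀ ⦃k : Type⦄ [Field k] ⦃Y : Scheme.{0}⦄ (f : Y ⟶ Spec (.of k)) [Smooth f] [IsSeparated f]
      [QuasiCompact f] (R : ReesAlgebraData Y), R.IsRegularWeightedCentre → ∀ U : Y.affineOpens,
      Scheme.IsRegular (affineCobordantBlowup (R.chartIdeals U)) ∧
        LocallyOfFiniteType (affineCobordantBlowup.π (R.chartIdeals U))) →
    ∀ ⦃k : Type⦄ [Field k] [PerfectField k] ⦃Y : Scheme.{0}⦄ (f : Y ⟶ Spec (.of k)) [Smooth f]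
      [IsSeparated f] [QuasiCompact f] (R : ReesAlgebraData Y), R.IsRegularWeightedCentre →
      ∀ U : Y.affineOpens, Smooth (R.cobordantPlusι U ≫ f) ∧ IsSeparated (R.cobordantPlusι U ≫ f) ∧
        QuasiCompact (R.cobordantPlusι U ≫ f) := by
  intro H k _ _ Y f _ _ _ R hR U
  obtain ⟨hreg, hlft⟩ := H f R hR U
  -- `Y` is locally Noetherian (locally of finite type over a field), so `Γ(Y, U)` is Noetherian
  haveI : IsLocallyNoetherian Y := LocallyOfFiniteType.isLocallyNoetherian f
  haveI : IsNoetherianRing Γ(Y, U) := IsLocallyNoetherian.component_noetherian U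
  -- `B(U)` is affine and locally Noetherian (locally of finite type over `Spec Γ(Y, U)`)
  haveI : IsAffine (affineCobordantBlowup (R.chartIdeals U)) := by
    unfold affineCobordantBlowup
    infer_instance
  haveI : IsLocallyNoetherian (affineCobordantBlowup (R.chartIdeals U)) :=
    LocallyOfFiniteType.isLocallyNoetherian (affineCobordantBlowup.π (R.chartIdeals U))
  -- `B₊(U)` is regular, as an open subscheme of the regular `B(U)`
  have hreg' :=
    isRegular_of_isOpenImmersion (affineCobordantBlowup.plusOpens (R.chartIdeals U)).ι hreg
  -- unfold the structure morphism `B₊(U) → Y` into its three constituents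
  unfold ReesAlgebraData.cobordantPlusι ReesAlgebraData.cobordantPlus affineCobordantBlowup.plusπ
    affineCobordantBlowup.plus
  exact ⟨smooth_of_isRegular_of_perfectField _ hreg', inferInstance, inferInstance⟩

end Summit.ResolutionOfSingularities.ResolutionOfSingularities.Theorems

end
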